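import Mathlib.Analysis.Calculus.ContDiff.RCLike
import Mathlib.Analysis.Calculus.ContDiff.Comp
import Mathlib.Analysis.Calculus.Deriv.Comp
import Mathlib.Analysis.Calculus.Deriv.Mul
import Mathlib.Analysis.Calculus.FDeriv.Prod
import Mathlib.Analysis.Normed.Operator.Prod
import HarnessLib

/-!
# Twice differentiating a concave fully nonlinear equation (Gilbarg–Trudinger (17.44)–(17.46))

The one-variable core of the Evans–Krylov argument. Along a line `t ↦ y + tγ` the equation
`F[u] = 0` reads `φ(t) = F(w(t), s(t)) ≡ 0`, where `s(t)` collects the second derivatives `D²u`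
(the slot in which `F` is concave) and `w(t)` the remaining arguments `(x, u, Du)`. Differentiating
twice at `t = 0`,

`0 = φ''(0) = D²F[(w',s'),(w',s')] + DF[(w'',s'')]`,

and concavity in `s` (`D²F[(0,s'),(0,s')] ≤ 0`) gives the one-sided bound

`DF(c₀)[(0, s'')] ≥ -(2‖D²F‖ ‖w'‖ ‖s'‖ + ‖D²F‖ ‖w'‖² + ‖DF‖ ‖w''‖)`

(`fderiv_snd_second_deriv_ge`): this is GT's (17.45)/(17.46) "`F_{ij}D_{ijγγ}u ≥ -A_{ijγ}D_{ijγ}u - B_γ`"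
with the structure `A₀|D³u| + B₀` of the right-hand side made explicit (`‖s'‖ ~ |D³u|`,
`‖w'‖ ~ 1 + |Du| + |D²u|`, `‖w''‖ ~ |D²u| + |D³u|`).

## References

* D. Gilbarg, N. S. Trudinger, *Elliptic Partial Differential Equations of Second Order* (2001),
  §17.4, (17.44)–(17.46). [GilbargTrudinger2001]
-/

noncomputable section

open Filter Set
open scoped Topology

namespace Literature.Analysis.PDE.EvansKrylov

variable {W S : Type*} [NormedAddCommGroup W] [NormedSpace ℝ W] [NormedAddCommGroup S]
  [NormedSpace ℝ S]

/-- **Second derivative of `F` along a `C²` curve**: for `φ = F ∘ c`,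
`φ''(0) = D²F(c₀)[c'(0)](c'(0)) + DF(c₀)[c''(0)]`. [folklore] -/
theorem hasDerivAt_deriv_comp_curve {F : W × S → ℝ} {c : ℝ → W × S} {c' c'' : ℝ → W × S}
    (hF : ContDiffAt ℝ 2 F (c 0)) (hc : ∀ᶠ t in 𝓝 0, HasDerivAt c (c' t) t)
    (hc' : HasDerivAt c' (c'' 0) 0) :
    HasDerivAt (fun t ↦ fderiv ℝ F (c t) (c' t))
      (fderiv ℝ (fderiv ℝ F) (c 0) (c' 0) (c' 0) + fderiv ℝ F (c 0) (c'' 0)) 0 := by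
  have hc0 : HasDerivAt c (c' 0) 0 := hc.self_of_nhds
  have hF2 : DifferentiableAt ℝ (fderiv ℝ F) (c 0) :=
    (ContDiffAt.fderiv_right hF (m := 1) (by norm_num)).differentiableAt (by norm_num)
  have h1 : HasDerivAt (fun t ↦ fderiv ℝ F (c t)) (fderiv ℝ (fderiv ℝ F) (c 0) (c' 0)) 0 :=
    hF2.hasFDerivAt.comp_hasDerivAt 0 hc0
  exact h1.clm_apply hc'

/-- The first derivative of `φ = F ∘ c` near `0`. [folklore] -/
theorem deriv_comp_curve_eventuallyEq {F : W × S → ℝ} {c : ℝ → W × S} {c' : ℝ → W × S}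
    (hF : ∀ᶠ t in 𝓝 0, DifferentiableAt ℝ F (c t)) (hc : ∀ᶠ t in 𝓝 0, HasDerivAt c (c' t) t) :
    deriv (F ∘ c) =ᶠ[𝓝 0] fun t ↦ fderiv ℝ F (c t) (c' t) := by
  filter_upwards [hF, hc] with t hFt hct
  exact (hFt.hasFDerivAt.comp_hasDerivAt t hct).deriv

/-- **`φ'' = 0` for the equation `F ∘ c ≡ 0`**: if `F(c(t)) = 0` near `t = 0` then
`D²F(c₀)[c'₀, c'₀] + DF(c₀)[c''₀] = 0`. [cite: GilbargTrudinger2001, (17.44)] -/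
theorem second_deriv_comp_curve_eq_zero {F : W × S → ℝ} {c : ℝ → W × S} {c' c'' : ℝ → W × S}
    (hF : ContDiffAt ℝ 2 F (c 0)) (hFd : ∀ᶠ t in 𝓝 0, DifferentiableAt ℝ F (c t))
    (hc : ∀ᶠ t in 𝓝 0, HasDerivAt c (c' t) t) (hc' : HasDerivAt c' (c'' 0) 0)
    (heq : ∀ᶠ t in 𝓝 0, F (c t) = 0) :
    fderiv ℝ (fderiv ℝ F) (c 0) (c' 0) (c' 0) + fderiv ℝ F (c 0) (c'' 0) = 0 := by
  have h2 := hasDerivAt_deriv_comp_curve hF hc hc'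
  -- `deriv (F ∘ c) = fun t ↦ DF(c t)(c' t)` near `0`, and `F ∘ c = 0` near `0`
  have h3 : HasDerivAt (deriv (F ∘ c))
      (fderiv ℝ (fderiv ℝ F) (c 0) (c' 0) (c' 0) + fderiv ℝ F (c 0) (c'' 0)) 0 :=
    h2.congr_of_eventuallyEq (deriv_comp_curve_eventuallyEq hFd hc)
  have h4 : deriv (F ∘ c) =ᶠ[𝓝 0] fun _ ↦ (0 : ℝ) := by
    filter_upwards [heq.eventually_nhds] with t ht
    have : (F ∘ c) =ᶠ[𝓝 t] fun _ ↦ (0 : ℝ) := ht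
    rw [this.deriv_eq]; simp
  have h5 : HasDerivAt (deriv (F ∘ c)) 0 0 :=
    (hasDerivAt_const 0 (0 : ℝ)).congr_of_eventuallyEq h4
  exact h3.unique h5

/-- **The concavity bound (GT (17.45)–(17.46), abstract form).** With `c = (w, s)`,
`F ∘ c ≡ 0` near `0`, `F` of class `C²` at `c₀`, and `F` concave in the `s`-slot in the direction
`s'(0)` (`D²F(c₀)[(0,s'₀),(0,s'₀)] ≤ 0`):
`DF(c₀)[(0, s''₀)] ≥ -(2‖D²F(c₀)‖‖w'₀‖‖s'₀‖ + ‖D²F(c₀)‖‖w'₀‖² + ‖DF(c₀)‖‖w''₀‖)`.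
[cite: GilbargTrudinger2001, (17.45)–(17.46)] -/
theorem fderiv_snd_second_deriv_ge {F : W × S → ℝ} {w : ℝ → W} {s : ℝ → S} {w' w'' : ℝ → W}
    {s' s'' : ℝ → S} (hF : ContDiffAt ℝ 2 F (w 0, s 0))
    (hFd : ∀ᶠ t in 𝓝 0, DifferentiableAt ℝ F (w t, s t))
    (hw : ∀ᶠ t in 𝓝 0, HasDerivAt w (w' t) t) (hs : ∀ᶠ t in 𝓝 0, HasDerivAt s (s' t) t)
    (hw' : HasDerivAt w' (w'' 0) 0) (hs' : HasDerivAt s' (s'' 0) 0)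
    (heq : ∀ᶠ t in 𝓝 0, F (w t, s t) = 0)
    (hconc : fderiv ℝ (fderiv ℝ F) (w 0, s 0) ((0 : W), s' 0) ((0 : W), s' 0) ≤ 0) :
    -(2 * ‖fderiv ℝ (fderiv ℝ F) (w 0, s 0)‖ * ‖w' 0‖ * ‖s' 0‖ +
        ‖fderiv ℝ (fderiv ℝ F) (w 0, s 0)‖ * ‖w' 0‖ ^ 2 + ‖fderiv ℝ F (w 0, s 0)‖ * ‖w'' 0‖) ≤
      fderiv ℝ F (w 0, s 0) ((0 : W), s'' 0) := by
  set c : ℝ → W × S := fun t ↦ (w t, s t) with hc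
  set c' : ℝ → W × S := fun t ↦ (w' t, s' t) with hc'
  set c'' : ℝ → W × S := fun t ↦ (w'' t, s'' t) with hc''
  have hcd : ∀ᶠ t in 𝓝 0, HasDerivAt c (c' t) t := by
    filter_upwards [hw, hs] with t hwt hst
    exact hwt.prodMk hst
  have hc'd : HasDerivAt c' (c'' 0) 0 := hw'.prodMk hs'
  have h0 := second_deriv_comp_curve_eq_zero (c := c) (c' := c') (c'' := c'') hF hFd hcd hc'd heq
  set B := fderiv ℝ (fderiv ℝ F) (w 0, s 0) with hB
  set L := fderiv ℝ F (w 0, s 0) with hL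
  -- split `c'₀ = (w'₀, 0) + (0, s'₀)` and `c''₀ = (w''₀, 0) + (0, s''₀)`
  have e1 : c' 0 = ((w' 0, (0 : S)) : W × S) + ((0 : W), s' 0) := by simp [hc']
  have e2 : c'' 0 = ((w'' 0, (0 : S)) : W × S) + ((0 : W), s'' 0) := by simp [hc'']
  have hexp : B (c' 0) (c' 0) = B (w' 0, 0) (w' 0, 0) + B (w' 0, 0) (0, s' 0) + B (0, s' 0) (w' 0, 0) +
      B (0, s' 0) (0, s' 0) := by
    rw [e1, map_add]; simp only [_root_.add_apply, map_add]; ring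
  have hLexp : L (c'' 0) = L (w'' 0, 0) + L (0, s'' 0) := by rw [e2, map_add]
  rw [hexp, hLexp] at h0
  -- norm bounds
  have nw : ‖((w' 0, (0 : S)) : W × S)‖ = ‖w' 0‖ := by simp [Prod.norm_def]
  have ns : ‖(((0 : W), s' 0) : W × S)‖ = ‖s' 0‖ := by simp [Prod.norm_def]
  have nw'' : ‖((w'' 0, (0 : S)) : W × S)‖ = ‖w'' 0‖ := by simp [Prod.norm_def]
  have b1 : |B (w' 0, 0) (w' 0, 0)| ≤ ‖B‖ * ‖w' 0‖ ^ 2 := by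
    have := (B (w' 0, 0)).le_opNorm (w' 0, 0)
    have h2 := B.le_opNorm ((w' 0, (0 : S)) : W × S)
    rw [Real.norm_eq_abs, nw] at this
    rw [nw] at h2
    calc |B (w' 0, 0) (w' 0, 0)| ≤ ‖B (w' 0, 0)‖ * ‖w' 0‖ := this
      _ ≤ ‖B‖ * ‖w' 0‖ * ‖w' 0‖ := mul_le_mul_of_nonneg_right h2 (norm_nonneg _)
      _ = ‖B‖ * ‖w' 0‖ ^ 2 := by ring
  have b2 : |B (w' 0, 0) (0, s' 0)| ≤ ‖B‖ * ‖w' 0‖ * ‖s' 0‖ := by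
    have := (B (w' 0, 0)).le_opNorm ((0 : W), s' 0)
    have h2 := B.le_opNorm ((w' 0, (0 : S)) : W × S)
    rw [Real.norm_eq_abs, ns] at this
    rw [nw] at h2
    exact this.trans (mul_le_mul_of_nonneg_right h2 (norm_nonneg _))
  have b3 : |B (0, s' 0) (w' 0, 0)| ≤ ‖B‖ * ‖w' 0‖ * ‖s' 0‖ := by
    have := (B (0, s' 0)).le_opNorm ((w' 0, (0 : S)) : W × S)
    have h2 := B.le_opNorm (((0 : W), s' 0) : W × S)
    rw [Real.norm_eq_abs, nw] at this
    rw [ns] at h2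
    calc |B (0, s' 0) (w' 0, 0)| ≤ ‖B (0, s' 0)‖ * ‖w' 0‖ := this
      _ ≤ ‖B‖ * ‖s' 0‖ * ‖w' 0‖ := mul_le_mul_of_nonneg_right h2 (norm_nonneg _)
      _ = ‖B‖ * ‖w' 0‖ * ‖s' 0‖ := by ring
  have b4 : |L (w'' 0, 0)| ≤ ‖L‖ * ‖w'' 0‖ := by
    have := L.le_opNorm ((w'' 0, (0 : S)) : W × S)
    rwa [Real.norm_eq_abs, nw''] at this
  have a1 := (abs_le.1 b1).2
  have a2 := (abs_le.1 b2).2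
  have a3 := (abs_le.1 b3).2
  have a4 := (abs_le.1 b4).2
  linarith

end Literature.Analysis.PDE.EvansKrylov

end
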